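import Summits.QuantumFields.BalabanUV.T4Continuum.Support.ShellMeasureWilsonWords

/-!
# `T4Continuum.ShellMeasureInterpAnalytic` — the two-point interpolation modulus from an analyticity–boundedness
# pair: (S-i) AT ANY LEVEL from (AN-bound) + (SM), for the one-depth engine, with NO transversal split
# (cell `pub-balaban`, sub-cell `t4`, spine estimate NE7c (node U5b); lineage t4-ne7c-p1 = PROVER seat P1
# «shell-measure route», generation 25; companion of `ShellMeasureWilson{Words,Trace,Block,Toy}`; ADDITIVE — imports
# `ShellMeasureWilsonWords` (p204908; transitively the lineage leaf `T4ShellMeasureAnalytic`) only)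

HONEST FRAMING.  Finite four-torus programme, rung (B)+1 only — NOT infinite volume, NOT a mass gap, NOT the Clay
problem, NOT summit progress; (B), `BetaPertHyp`, (B^μ) are not consumed.  (M1) for Bałaban's inductively defined
measures is NOT PRINTED (GAPS G-ne7cp1-1) and NOT moved.  This file is [folklore] kernel bookkeeping on the INPUT LIST of
the smooth member at the LIVE levels `j ≥ 1` (GAPS G-ne7cp1-21, G-ne7cp1-26): 0 sorry, 0 citations, nothing of the
audited series asserted.  HONEST DEPENDENCY (cell): continuum YM on T⁴ ⇐ BetaPertH ∧ nine spine estimates (0/9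
proved); BetaPertH ⇐ (D1) ∧ (D4) ∧ CAP+tail; G-an2-4 gates asym, D1 and NE2/3/4.

THE POINT.  The one-depth engine (`ShellMeasureScalingLocal.slotAntiConcentration_of_coreMap`) needs of the classifier
only the CORE MAP (S-i), and `ShellMeasureWilsonWords` showed at level 0 that the core map follows from a TWO-POINT
INTERPOLATION MODULUS `‖h(c) − c·h(1)‖ ≤ c(1−c)·K` of each plaquette functional along the contraction plus the smallness
`K ≤ δθ`.  Here: (§1) the modulus follows from NEAR-LINEARITY of `h` AND `h′` (`‖h(z) − z·a‖ ≤ Cz²`,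
`‖h′(z) − a‖ ≤ Cz` on `(0, z₀]`) with `K = 4C·z₀²` — elementary: the bound `∝ c` is the triangle inequality, the bound
`∝ (1 − c)` is the mean-value inequality for `φ(c) = h(cz₀) − c·h(z₀)` (`‖φ′‖ ≤ 2Cz₀²`, `φ(1) = 0`), and
`min(c, 1−c) ≤ 2c(1−c)`; (§2) near-linearity of `h` and `h′` is exactly what the lineage's Cauchy estimate
`T4ShellMeasureAnalytic.nearLinear_of_differentiableOn_ball` extracts from an ANALYTICITY–BOUNDEDNESS PAIR `(R, H)`
(`f` complex differentiable with `‖f‖ ≤ H` on `‖w‖ < R`, `f 0 = 0`, `x₀ < R`), with `C = cauchyCoef H R x₀ = 9H/(R − x₀)²`;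
so `K = 36·H·x₀²/(R − x₀)²` (`interp_of_differentiableOn_ball`); (§3) hence the CORE MAP AT ANY LEVEL
(`coreMap_of_analytic_family`): per plaquette an analyticity pair on the complexified contraction ray, the smallness
(SM) `36Hx₀²/(R − x₀)² ≤ δθ`, every functional below `θ` at the point ⇒ every functional below `θ(1−ρ)` after the
contraction `c = 1 − ρ/(1−δ)` — for ALL plaquettes alike: NO transversal/degenerate split, NO onset, NO lower bound on
‖f‖ (the route of `T4ShellMeasureAnalytic` §5 needed the multiplicative decay `d/dr log‖f‖ ≤ −(1−δ)`, which fails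
where ‖f‖ ≪ Cz² and forced the transversal proxy (dead end D10); the interpolation route does not).
CONSEQUENCE FOR THE LEDGER (G-ne7cp1-26): at a live level `j` the located input (S-i)_j of the smooth member IS
(AN-bound)_j — the analyticity–boundedness pair, uniform in `k`, of the plaquette functionals
`c ↦ U_{j,□}(exp(c·x))(∂p) − 1` of the localized minimiser on a complex disc in the contraction parameter (B11 Prop. 9
TYPE; GAPS G-ne7cp1-8a ∕ -14: NOT displayed as numbers) — plus (SM)_j; nothing else.

WHAT THIS DOES NOT DO.  No instance of (AN-bound) at any `j ≥ 1`; (S-ii)_j, (LR), (MR), (W1), (F∞)-rate unchanged;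
NE7c NOT proved; 0/9 spine.
-/

noncomputable section

open NormedSpace Set Metric

namespace Summit.QuantumFields.BalabanUV.T4Continuum.ShellMeasureInterpAnalytic

open Literature.MathematicalPhysics.QuantumFieldTheory.Balaban1983to89
open T4ShellMeasureAnalytic (cauchyCoef cauchyCoef_nonneg nearLinear_of_differentiableOn_ball)
open ShellMeasureWilsonWords (norm_real_smul depth_admissible)

/-! ## §1 The interpolation modulus from near-linearity of `h` and `h′` -/

section NearLinear

variable {F : Type*} [NormedAddCommGroup F] [NormedSpace ℝ F]

/-- `min(c, 1 − c) ≤ 2c(1−c)` on `[0,1]`, in the form used below. [folklore] -/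
theorem min_le_two_mul {c M : ℝ} (hc0 : 0 ≤ c) (hc1 : c ≤ 1) {x : ℝ} (h1 : x ≤ M * c)
    (h2 : x ≤ M * (1 - c)) : x ≤ 2 * M * (c * (1 - c)) := by
  rcases le_total c (1 / 2) with h | h
  · nlinarith
  · nlinarith

/-- **THE TWO-POINT INTERPOLATION MODULUS FROM NEAR-LINEARITY.**  If `h : ℝ → F` is differentiable on `(0, z₀]` with
`‖h z − z·a‖ ≤ C z²` and `‖h′ z − a‖ ≤ C z` there (`C ≥ 0`, `z₀ > 0`), then for `0 < c ≤ 1`: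
`‖h(c·z₀) − c·h(z₀)‖ ≤ 4C·z₀²·c(1−c)`. [folklore] -/
theorem interp_of_nearLinear {h h' : ℝ → F} {a : F} {C z₀ : ℝ} (hz₀ : 0 < z₀) (hC : 0 ≤ C)
    (hd : ∀ z ∈ Ioc 0 z₀, HasDerivAt h (h' z) z) (hlin : ∀ z ∈ Ioc 0 z₀, ‖h z - z • a‖ ≤ C * z ^ 2)
    (hder : ∀ z ∈ Ioc 0 z₀, ‖h' z - a‖ ≤ C * z) {c : ℝ} (hc0 : 0 < c) (hc1 : c ≤ 1) :
    ‖h (c * z₀) - c • h z₀‖ ≤ 4 * C * z₀ ^ 2 * (c * (1 - c)) := by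
  have hz₀mem : z₀ ∈ Ioc 0 z₀ := ⟨hz₀, le_rfl⟩
  have hcz : c * z₀ ∈ Ioc 0 z₀ := ⟨mul_pos hc0 hz₀, by nlinarith⟩
  -- the bound ∝ c : triangle inequality
  have hA : ‖h (c * z₀) - c • h z₀‖ ≤ 2 * C * z₀ ^ 2 * c := by
    have e : h (c * z₀) - c • h z₀ = (h (c * z₀) - (c * z₀) • a) - c • (h z₀ - z₀ • a) := by
      rw [smul_sub, smul_smul]; abel
    rw [e]
    calc ‖(h (c * z₀) - (c * z₀) • a) - c • (h z₀ - z₀ • a)‖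
        ≤ ‖h (c * z₀) - (c * z₀) • a‖ + ‖c • (h z₀ - z₀ • a)‖ := norm_sub_le _ _
      _ ≤ C * (c * z₀) ^ 2 + c * (C * z₀ ^ 2) := by
          rw [norm_smul, Real.norm_of_nonneg hc0.le]
          exact add_le_add (hlin _ hcz) (mul_le_mul_of_nonneg_left (hlin _ hz₀mem) hc0.le)
      _ ≤ 2 * C * z₀ ^ 2 * c := by nlinarith [mul_nonneg hC (sq_nonneg z₀), mul_nonneg hc0.le (mul_nonneg hC (sq_nonneg z₀))]
  -- the bound ∝ (1 − c) : mean value inequality for φ(t) = h(t z₀) − t • h z₀ on [c, 1]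
  have hB : ‖h (c * z₀) - c • h z₀‖ ≤ 2 * C * z₀ ^ 2 * (1 - c) := by
    set φ : ℝ → F := fun t => h (t * z₀) - t • h z₀ with hφ
    have hφ1 : φ 1 = 0 := by simp [hφ]
    have hderiv : ∀ t ∈ Icc c 1, HasDerivWithinAt φ (z₀ • h' (t * z₀) - h z₀) (Icc c 1) t := by
      intro t ht
      have htz : t * z₀ ∈ Ioc 0 z₀ := ⟨mul_pos (hc0.trans_le ht.1) hz₀, by nlinarith [ht.2]⟩
      have h1 : HasDerivAt (fun t : ℝ => h (t * z₀)) (z₀ • h' (t * z₀)) t := by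
        have hlinmap : HasDerivAt (fun t : ℝ => t * z₀) z₀ t := by
          simpa using (hasDerivAt_id t).mul_const z₀
        exact (hd _ htz).scomp t hlinmap
      have h2 : HasDerivAt (fun t : ℝ => t • h z₀) (h z₀) t := by
        simpa using (hasDerivAt_id t).smul_const (h z₀)
      exact (h1.sub h2).hasDerivWithinAt
    have hbound : ∀ t ∈ Ico c 1, ‖z₀ • h' (t * z₀) - h z₀‖ ≤ 2 * C * z₀ ^ 2 := by
      intro t ht
      have htz : t * z₀ ∈ Ioc 0 z₀ := ⟨mul_pos (hc0.trans_le ht.1) hz₀, by nlinarith [ht.2.le]⟩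
      have e : z₀ • h' (t * z₀) - h z₀ = z₀ • (h' (t * z₀) - a) - (h z₀ - z₀ • a) := by
        rw [smul_sub]; abel
      rw [e]
      calc ‖z₀ • (h' (t * z₀) - a) - (h z₀ - z₀ • a)‖ ≤ ‖z₀ • (h' (t * z₀) - a)‖ + ‖h z₀ - z₀ • a‖ := norm_sub_le _ _
        _ ≤ z₀ * (C * (t * z₀)) + C * z₀ ^ 2 := by
            rw [norm_smul, Real.norm_of_nonneg hz₀.le]
            exact add_le_add (mul_le_mul_of_nonneg_left (hder _ htz) hz₀.le) (hlin _ hz₀mem)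
        _ ≤ 2 * C * z₀ ^ 2 := by nlinarith [mul_nonneg hC (sq_nonneg z₀), ht.2.le, mul_nonneg (mul_nonneg hC (sq_nonneg z₀)) (hc0.le.trans ht.1)]
    have hmv := norm_image_sub_le_of_norm_deriv_le_segment' hderiv hbound 1 (right_mem_Icc.2 hc1)
    rw [hφ1, zero_sub, norm_neg] at hmv
    simpa [hφ, mul_comm] using hmv
  have := min_le_two_mul hc0.le hc1 hA hB
  linarith [this]

end NearLinear

/-! ## §2 The modulus from an analyticity–boundedness pair (Cauchy) -/

section Analytic

variable {F : Type*} [NormedAddCommGroup F] [NormedSpace ℂ F] [CompleteSpace F]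

/-- **THE INTERPOLATION MODULUS FROM (AN-bound).**  `f : ℂ → F` complex differentiable with `‖f‖ ≤ H` on `‖w‖ < R`,
`f 0 = 0`, `0 < x₀ < R`: for every ray parameter `z₀ ∈ (0, x₀]` and `0 < c ≤ 1`,
`‖f(c·z₀) − c·f(z₀)‖ ≤ 4·cauchyCoef H R x₀·z₀²·c(1−c)` (`cauchyCoef H R x₀ = 9H/(R − x₀)²`). [folklore] -/
theorem interp_of_differentiableOn_ball {f : ℂ → F} {R H x₀ : ℝ} (hx₀ : 0 < x₀) (hR : x₀ < R)
    (hf : DifferentiableOn ℂ f (ball 0 R)) (hH : ∀ w ∈ ball (0 : ℂ) R, ‖f w‖ ≤ H) (hf0 : f 0 = 0)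
    {z₀ : ℝ} (hz₀ : z₀ ∈ Ioc 0 x₀) {c : ℝ} (hc0 : 0 < c) (hc1 : c ≤ 1) :
    ‖f ((c * z₀ : ℝ) : ℂ) - c • f (z₀ : ℂ)‖ ≤ 4 * cauchyCoef H R x₀ * z₀ ^ 2 * (c * (1 - c)) := by
  have hH0 : 0 ≤ H := (norm_nonneg _).trans (hH 0 (mem_ball_self (hx₀.trans hR)))
  have hnl := nearLinear_of_differentiableOn_ball hx₀.le hR hf hH hf0
  have hsub : ∀ z ∈ Ioc 0 z₀, z ∈ Ioc 0 x₀ := fun z hz => ⟨hz.1, hz.2.trans hz₀.2⟩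
  exact interp_of_nearLinear (h := fun y : ℝ => f y) (h' := fun y : ℝ => deriv f y) (a := deriv f 0) hz₀.1
    (cauchyCoef_nonneg hH0) (fun z hz => (hnl z (hsub z hz)).1) (fun z hz => (hnl z (hsub z hz)).2.1)
    (fun z hz => (hnl z (hsub z hz)).2.2) hc0 hc1

/-- the uniform form on the window: for `z₀ ≤ x₀` the modulus is `≤ 36·H·x₀²/(R − x₀)²·c(1−c)`. [folklore] -/
theorem interp_of_differentiableOn_ball_le {f : ℂ → F} {R H x₀ : ℝ} (hx₀ : 0 < x₀) (hR : x₀ < R)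
    (hf : DifferentiableOn ℂ f (ball 0 R)) (hH : ∀ w ∈ ball (0 : ℂ) R, ‖f w‖ ≤ H) (hf0 : f 0 = 0)
    {z₀ : ℝ} (hz₀ : z₀ ∈ Ioc 0 x₀) {c : ℝ} (hc0 : 0 < c) (hc1 : c ≤ 1) :
    ‖f ((c * z₀ : ℝ) : ℂ) - c • f (z₀ : ℂ)‖ ≤ c * (1 - c) * (36 * H * x₀ ^ 2 / (R - x₀) ^ 2) := by
  have hH0 : 0 ≤ H := (norm_nonneg _).trans (hH 0 (mem_ball_self (hx₀.trans hR)))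
  have h := interp_of_differentiableOn_ball hx₀ hR hf hH hf0 hz₀ hc0 hc1
  have hC := cauchyCoef_nonneg (H := H) (R := R) (x₀ := x₀) hH0
  have hz : z₀ ^ 2 ≤ x₀ ^ 2 := pow_le_pow_left₀ hz₀.1.le hz₀.2 2
  have hcc : 0 ≤ c * (1 - c) := mul_nonneg hc0.le (by linarith)
  calc ‖f ((c * z₀ : ℝ) : ℂ) - c • f (z₀ : ℂ)‖ ≤ 4 * cauchyCoef H R x₀ * z₀ ^ 2 * (c * (1 - c)) := h
    _ ≤ 4 * cauchyCoef H R x₀ * x₀ ^ 2 * (c * (1 - c)) := by gcongr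
    _ = c * (1 - c) * (36 * H * x₀ ^ 2 / (R - x₀) ^ 2) := by unfold cauchyCoef; ring

end Analytic

/-! ## §3 (S-i) at any level: the core map from analyticity pairs and (SM), all plaquettes alike -/

section CoreMap

variable {F : Type*} [NormedAddCommGroup F] [NormedSpace ℂ F]

/-- **THE CORE MAP FROM A TWO-POINT INTERPOLATION MODULUS** (level-`j`-ready form of
`ShellMeasureWilsonWords.coreMap_sup`): for ANY non-empty finite family of plaquette functionals `h p : ℝ → F` along
the contraction with `‖h p c − c·h p 1‖ ≤ c(1−c)·K`, `K ≤ δθ`, `θ > 0`: every functional below `θ` at `c = 1` ⇒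
every functional below `θ(1−ρ)` at any depth `0 < c ≤ 1` with `c(1 + δ(1−c)) ≤ 1 − ρ`. [folklore] -/
theorem coreMap_of_interp {ι : Type*} {Ps : Finset ι} (hPs : Ps.Nonempty) (h : ι → ℝ → F) {c θ δ ρ K : ℝ}
    (hc0 : 0 < c) (hc1 : c ≤ 1) (hθ : 0 < θ) (hK : K ≤ δ * θ)
    (hinterp : ∀ p ∈ Ps, ‖h p c - c • h p 1‖ ≤ c * (1 - c) * K) (hcρ : c * (1 + δ * (1 - c)) ≤ 1 - ρ)
    (h1 : Ps.sup' hPs (fun p => ‖h p 1‖) < θ) :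
    Ps.sup' hPs (fun p => ‖h p c‖) < θ * (1 - ρ) := by
  rw [Finset.sup'_lt_iff] at h1 ⊢
  intro p hp
  have h1c : 0 ≤ 1 - c := by linarith
  have hle : ‖h p c‖ ≤ c * ‖h p 1‖ + c * (1 - c) * K := by
    calc ‖h p c‖ = ‖c • h p 1 + (h p c - c • h p 1)‖ := by congr 1; abel
      _ ≤ ‖c • h p 1‖ + ‖h p c - c • h p 1‖ := norm_add_le _ _
      _ ≤ c * ‖h p 1‖ + c * (1 - c) * K := by
          rw [norm_smul, Real.norm_of_nonneg hc0.le]; gcongr; exact hinterp p hp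
  have hlt : c * ‖h p 1‖ + c * (1 - c) * K < c * θ + c * (1 - c) * (δ * θ) := by
    have h2 : c * (1 - c) * K ≤ c * (1 - c) * (δ * θ) := mul_le_mul_of_nonneg_left hK (mul_nonneg hc0.le h1c)
    have h3 : c * ‖h p 1‖ < c * θ := mul_lt_mul_of_pos_left (h1 p hp) hc0
    linarith
  calc ‖h p c‖ < c * θ + c * (1 - c) * (δ * θ) := hle.trans_lt hlt
    _ = θ * (c * (1 + δ * (1 - c))) := by ring
    _ ≤ θ * (1 - ρ) := mul_le_mul_of_nonneg_left hcρ hθ.le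

variable [CompleteSpace F]

/-- **(S-i) AT ANY LEVEL FROM (AN-bound) + (SM), NO TRANSVERSAL SPLIT.**  Per plaquette `p ∈ P` a functional
`f p : ℂ → F` complex differentiable with `‖f p‖ ≤ H` on `‖w‖ < R` and `f p 0 = 0` (the analyticity–boundedness pair
of the plaquette functional of the contraction ray — at `j ≥ 1` the located (AN-bound) of GAPS G-ne7cp1-8a ∕ -14, NOT
instantiated here), a ray parameter `z₀ ∈ (0, x₀]` of the point (`x₀ < R`), the smallness (SM)
`36·H·x₀²/(R − x₀)² ≤ δ·θ` (`0 ≤ δ < 1`, `θ > 0`), and `0 ≤ ρ < 1 − δ`.  If every `‖f p (z₀)‖ < θ` then after the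
contraction `c = 1 − ρ/(1−δ)`: every `‖f p (c·z₀)‖ < θ(1−ρ)` — the core map (S-i) for the max-classifier, for all
plaquettes alike (degenerate directions included). [folklore] -/
theorem coreMap_of_analytic_family {ι : Type*} {Ps : Finset ι} (hPs : Ps.Nonempty) {f : ι → ℂ → F}
    {R H x₀ θ δ ρ : ℝ} (hx₀ : 0 < x₀) (hR : x₀ < R)
    (hf : ∀ p ∈ Ps, DifferentiableOn ℂ (f p) (ball 0 R)) (hH : ∀ p ∈ Ps, ∀ w ∈ ball (0 : ℂ) R, ‖f p w‖ ≤ H)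
    (hf0 : ∀ p ∈ Ps, f p 0 = 0) {z₀ : ℝ} (hz₀ : z₀ ∈ Ioc 0 x₀) (hθ : 0 < θ) (hδ0 : 0 ≤ δ) (hδ1 : δ < 1)
    (hρ0 : 0 ≤ ρ) (hρ : ρ < 1 - δ) (hSM : 36 * H * x₀ ^ 2 / (R - x₀) ^ 2 ≤ δ * θ)
    (h1 : Ps.sup' hPs (fun p => ‖f p (z₀ : ℂ)‖) < θ) :
    Ps.sup' hPs (fun p => ‖f p (((1 - ρ / (1 - δ)) * z₀ : ℝ) : ℂ)‖) < θ * (1 - ρ) := by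
  have h1δ : 0 < 1 - δ := by linarith
  have hc0 : 0 < 1 - ρ / (1 - δ) := by
    rw [sub_pos, div_lt_one h1δ]; exact hρ
  have hc1 : 1 - ρ / (1 - δ) ≤ 1 := by
    have : 0 ≤ ρ / (1 - δ) := div_nonneg hρ0 h1δ.le
    linarith
  have key := coreMap_of_interp hPs (fun p (c : ℝ) => f p ((c * z₀ : ℝ) : ℂ)) hc0 hc1 hθ hSM
    (fun p hp => by
      simpa only [one_mul] using interp_of_differentiableOn_ball_le hx₀ hR (hf p hp) (hH p hp) (hf0 p hp) hz₀ hc0 hc1)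
    (depth_admissible hδ0 hδ1 hρ0) (by simpa only [one_mul] using h1)
  simpa only using key

end CoreMap

end Summit.QuantumFields.BalabanUV.T4Continuum.ShellMeasureInterpAnalytic
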